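import Literature.Probability.RandomPlanarGeometry.HexSAWStripBetaCoefficientLaw
import Literature.Probability.RandomPlanarGeometry.HexSAWStripBridgeLengthPointwise
import HarnessLib

/-!
# The critical bridges of the honeycomb strip by LENGTH at the threshold: `c · N − C ≤ Σ_{a,b} D_N(a,b)(y_T) ≤ K · N`
# (the two-sided LINEAR LAW IN LENGTH — module «BRIDGE-LENGTH-LINEAR»)

Topic `Literature/Probability/RandomPlanarGeometry` (continues «BETA-COEFF» `HexSAWStripBetaCoefficientLaw.lean` — the `y`-series of the
renewal pieces `HV.headGFN` / `HV.hb0GFN` / `HV.tailGFN` and their bounds AT `y_T` (`HV.exists_headGFN_stripYT_le`,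
`HV.exists_tailGFN_stripYT_le`); «BETA-SPLIT» `HexSAWStripBetaRenewalSplit.lean` (the split `fstP` / `midPc` / `tailPc`, `HV.renA`);
«BETA-NORENEWAL» `HexSAWStripBetaNoRenewal.lean` (`HV.noRenA`, `HV.exists_sum_noRenA_stripYT_le`); «LENGTH-POINTWISE»
`HexSAWStripBridgeLengthPointwise.lean` (`HV.LUs`, `HV.exists_LUs_stripYT_le`: the bridges with exactly `σ` steps weigh `≤ K` at `y_T`);
«LINEAR-LOWER» `HexSAWStripThresholdLinearLower.lean` (`HV.exists_linear_le_stripGFy_beta_stripYT`: `B_{T,L}(x_c; y_T) ≥ c (L+1) − C`,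
`HV.LinLow.card_stripV_le_affine`)).  Lane «pcv-sawmu» (CriticalPhenomena venture), a-p2 g21.  Sources of the SETTING: H. Duminil-Copin,
A. Hammond, CMP 324 (2013) §2.2 (bridges, renewal points); N. R. Beaton, M. Bousquet-Mélou, J. de Gier, H. Duminil-Copin, A. J. Guttmann,
CMP 326 (2014) §3.2 and Corollary 8 (arXiv:1109.0358v5 p. 12: `y_T`); H. Duminil-Copin, S. Smirnov, Ann. Math. 175 (2012) §3 (`S_{T,L}`).
Nothing of the kind is printed (the strip series are rational in print; no transfer matrix is used here).

## What is proved (namespace `Literature.Probability.RandomPlanarGeometry.SAW.HV`; `y_T = stripYT T`)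

* §1 ★ `sum_renA_le_sum_pieces` — `Σ_{ω ∈ renA T L} x_c^{|ω|} y^{#top} ≤ Σ_{c,e} F^{(N)}_c(y) D⁰^{(N)}_{ce}(y) G^{(N)}_e(y)` for
  `N + 1 ≥ |V(S_{T,L})|` (the injection of «BETA-SPLIT» with `y`-weights); ★★ `stripGFy_beta_le_two_mul_renewal` —
  `B_{T,L}(x_c; y) ≤ 2 (Σ_{N₀^A} + Σ_{c,e} F^{(N)} D⁰^{(N)} G^{(N)})`: the renewal split ABOVE the β-series of a box, at the level of
  generating functions (twin of the coefficientwise `stripBcoeffY_le_renewal`).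
* §2 `exists_headGFN_stripYT_le_all`, `exists_tailGFN_stripYT_le_all` (bounds uniform in the level), `hb0GFN_le_Dab_add`
  (`D⁰^{(N)}_{ce} ≤ D_N(c,e) + |stripChains T 0|`).
* §3 `Dab_eq_sum_LUs` — `D_N(a,b)(y) = Σ_{σ=1}^{N} LUs T N σ a b y` (a bridge of a box has `1 ≤ σ ≤ N` steps); ★★
  `exists_sum_Dab_stripYT_le_linear` — `Σ_{a,b} D_N(a,b)(y_T) ≤ K · N` (from «LENGTH-POINTWISE»).
* §4 ★★★ `exists_linear_le_sum_Dab_stripYT` — `∃ c > 0, ∃ C, ∀ N, c · N − C ≤ Σ_{a,b} D_N(a,b)(y_T)` (`T ≥ 2`): the standard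
  horizontal bridges of `S_T` with at most `N + 1` vertices weigh AT LEAST of order `N` at the threshold.  Route: the box `S_{T,L}` with
  `|V(S_{T,L})| ≤ N + 1`, `L ≍ N`; its β-series at `y_T` is `≥ c₀(L+1) − C₀` («LINEAR-LOWER») and `≤ 2(Σ_{N₀^A} + Σ F D⁰ G)` (§1);
  the no-renewal class is bounded («BETA-NORENEWAL»), the head and tail series are bounded at `y_T` («BETA-COEFF» §4) and `D⁰ ≤ D + const`.
  With §3 the TWO-SIDED LINEAR LAW IN LENGTH `Σ_{a,b} D_N(a,b)(y_T) ≍ N` holds — the first-order input in the LENGTH variable for the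
  lane's length programme (the `x`-residue of the bridge kernel at `y = y_T`, HANDOFF a-p2 g19 (B)), previously missing on the lower side.

Label: LANE THEOREM (own result of lane «pcv-sawmu», a-p2 g21, 2026-08-26).  NOT claimed: the limit of `Σ_{a,b} D_N(a,b)(y_T)/N`
(the Cesàro law in length), entrywise lower bounds, anything in the variable `x`, `T = 1`, uniformity in `T`.
-/

noncomputable section

open Finset Filter Topology Literature.Probability.LatticeModels Literature.Probability.Percolation

namespace Literature.Probability.RandomPlanarGeometry.SAW

namespace HV

variable {T : ℕ}

/-! ### §1 The renewal split ABOVE the β-series of a box, with `y`-weights -/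

section UpperSplit

variable {L N : ℕ} {y : ℝ}

/-- The product of the three piece series as a sum over triples (plumbing). [cite: DuminilCopinHammond2013, §2.2; lane plumbing] -/
theorem headGFN_mul_hb0GFN_mul_tailGFN_eq_sum (N₁ N₂ N₃ : ℕ) (c e : ℤ) (y : ℝ) :
    headGFN T N₁ c y * hb0GFN T N₂ c e y * tailGFN T N₃ e y =
      ∑ t ∈ headN T N₁ c ×ˢ (HB0 T N₂ c e ×ˢ tailN T N₃ e),
        hexCriticalFugacity ^ t.1.length * y ^ topCnt T t.1 * (wD T y t.2.1 * wD T y t.2.2) := by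
  rw [headGFN, hb0GFN, tailGFN, mul_assoc, sum_mul_sum (HB0 T N₂ c e) (tailN T N₃ e), sum_mul_sum, sum_product]
  refine sum_congr rfl fun h _ => ?_
  rw [sum_product]
  refine sum_congr rfl fun b _ => ?_
  rw [mul_sum]

/-- The levels of the first and the last renewal vertex of a β-walk with a renewal index lie in `0 … 2T−1` (plumbing).
[cite: DuminilCopinSmirnov2012, §3 (levels of S_T); lane plumbing] -/
theorem renLevels_mem (hT : 1 ≤ T) {l : List HV} (hl : l ∈ renA T L) :
    (ltLev (fstP l), hdLev (tailPc l)) ∈ Icc (0 : ℤ) (2 * (T : ℤ) - 1) ×ˢ Icc (0 : ℤ) (2 * (T : ℤ) - 1) := by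
  have hlen : l.length ≤ l.length - 1 + 1 := by omega
  have h1 := fstP_mem_headN hT hl hlen
  have h3 := tailPc_mem_tailN hT hl hlen
  rw [mem_product, mem_Icc, mem_Icc]
  constructor
  · by_contra hc
    have := headN_eq_empty_of_not_mem (T := T) (by rintro ⟨h0, h1'⟩; exact hc ⟨h0, h1'⟩) (l.length - 1)
    rw [this] at h1
    simp at h1
  · by_contra he
    have := tailN_eq_empty_of_not_mem (T := T) (by rintro ⟨h0, h1'⟩; exact he ⟨h0, h1'⟩) (l.length - 1)
    rw [this] at h3
    simp at h3

/-- ★ **The walks with a renewal index, split with `y`-weights**: for `N + 1 ≥ |V(S_{T,L})|` and `y ≥ 0`,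
`Σ_{ω ∈ renA T L} x_c^{|ω|} y^{#top(ω)} ≤ Σ_{c,e} F^{(N)}_c(y) · D⁰^{(N)}_{ce}(y) · G^{(N)}_e(y)` (the injection
`ω ↦ (head, middle bridge, tail)` of «BETA-SPLIT», weights multiplying). [cite: DuminilCopinHammond2013, §2.2 (unique decomposition at renewal points); BeatonBousquetMelouDeGierDuminilCopinGuttmann2014, §3.2; lane «pcv-sawmu» a-p2 g21] -/
theorem sum_renA_le_sum_pieces (hT : 1 ≤ T) (hN : (stripV T L).card ≤ N + 1) (hy : 0 ≤ y) :
    ∑ l ∈ renA T L, hexCriticalFugacity ^ l.length * y ^ topCnt T l ≤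
      ∑ c ∈ Icc (0 : ℤ) (2 * (T : ℤ) - 1), ∑ e ∈ Icc (0 : ℤ) (2 * (T : ℤ) - 1),
        headGFN T N c y * hb0GFN T N c e y * tailGFN T N e y := by
  classical
  have hx := hexCriticalFugacity_pos_lt_one
  set W : List HV → ℝ := fun l => hexCriticalFugacity ^ l.length * y ^ topCnt T l with hW
  set W3 : List HV × List HV × List HV → ℝ := fun t => W t.1 * (wD T y t.2.1 * wD T y t.2.2) with hW3
  have hW30 : ∀ t, 0 ≤ W3 t := fun t =>
    mul_nonneg (mul_nonneg (pow_nonneg hx.1.le _) (pow_nonneg hy _)) (mul_nonneg (wD_nonneg T hy _) (wD_nonneg T hy _))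
  set τ : List HV → ℤ × ℤ := fun l => (ltLev (fstP l), hdLev (tailPc l)) with hτ
  -- fiberwise by the two renewal levels
  rw [← sum_product (s := Icc (0 : ℤ) (2 * (T : ℤ) - 1)) (t := Icc (0 : ℤ) (2 * (T : ℤ) - 1))
    (f := fun ce => headGFN T N ce.1 y * hb0GFN T N ce.1 ce.2 y * tailGFN T N ce.2 y),
    ← sum_fiberwise_of_maps_to (s := renA T L) (g := τ) (fun l hl => renLevels_mem hT hl)]
  refine sum_le_sum fun ce _ => ?_
  obtain ⟨c, e⟩ := ce
  -- data of the fiber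
  have hmem : ∀ l ∈ (renA T L).filter (fun l => τ l = (c, e)),
      l ∈ renA T L ∧ (renIdxs l).Nonempty ∧ l.length ≤ N + 1 ∧ ltLev (fstP l) = c ∧ hdLev (tailPc l) = e := by
    intro l hl
    rw [mem_filter] at hl
    have h1 := hl.1
    rw [renA, mem_filter] at h1
    simp only [hτ, Prod.mk.injEq] at hl
    exact ⟨hl.1, h1.2, (length_le_card_stripV hT h1.1).trans hN, hl.2.1, hl.2.2⟩
  rw [headGFN_mul_hb0GFN_mul_tailGFN_eq_sum]
  calc ∑ l ∈ (renA T L).filter (fun l => τ l = (c, e)), W l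
      = ∑ l ∈ (renA T L).filter (fun l => τ l = (c, e)), W3 (fstP l, midPc l, tailPc l) := by
        refine sum_congr rfl fun l hl => ?_
        obtain ⟨-, hne, -⟩ := hmem l hl
        obtain ⟨hlenl, htop⟩ := length_topCnt_threePieces hne T
        simp only [hW3, hW, wD]
        rw [hlenl, htop, pow_add, pow_add, pow_add, pow_add]
        ring
    _ = ∑ t ∈ ((renA T L).filter (fun l => τ l = (c, e))).image (fun l => (fstP l, midPc l, tailPc l)), W3 t := by
        rw [sum_image]
        intro l hl l' hl' heq
        exact threePieces_injOn (hmem l hl).2.1 (hmem l' hl').2.1 heq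
    _ ≤ ∑ t ∈ headN T N c ×ˢ (HB0 T N c e ×ˢ tailN T N e), W3 t := by
        refine sum_le_sum_of_subset_of_nonneg (fun t ht => ?_) fun t _ _ => hW30 t
        rw [mem_image] at ht
        obtain ⟨l, hl, rfl⟩ := ht
        obtain ⟨hren, hne, hlen, h1, h2⟩ := hmem l hl
        obtain ⟨hl1, hl2, -⟩ := threePieces_levels hne
        rw [mem_product, mem_product]
        refine ⟨?_, ?_, ?_⟩
        · rw [← h1]; exact fstP_mem_headN hT hren hlen
        · rw [← h1, ← h2, hl1, ← hl2]; exact midPc_mem_HB0 hT hren hlen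
        · rw [← h2]; exact tailPc_mem_tailN hT hren hlen

/-- ★★ **THE RENEWAL SPLIT ABOVE THE β-SERIES OF A BOX**: for `N + 1 ≥ |V(S_{T,L})|` and `y ≥ 0`,
`B_{T,L}(x_c; y) ≤ 2 · ( Σ_{ω ∈ N₀^A(S_{T,L})} x_c^{|ω|} y^{#top(ω)} + Σ_{c,e} F^{(N)}_c(y) D⁰^{(N)}_{ce}(y) G^{(N)}_e(y) )`
(case B mirrors onto case A; case A splits into the no-renewal class and the glued triples).
[cite: DuminilCopinSmirnov2012, §3 (B_{T,L}, the mirror symmetry of S_{T,L}); DuminilCopinHammond2013, §2.2; BeatonBousquetMelouDeGierDuminilCopinGuttmann2014, §3.2; lane «pcv-sawmu» a-p2 g21] -/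
theorem stripGFy_beta_le_two_mul_renewal (hT : 1 ≤ T) (hN : (stripV T L).card ≤ N + 1) (hy : 0 ≤ y) :
    stripGFy T L (IsBetaDart T) y ≤ 2 * (∑ l ∈ noRenA T L, hexCriticalFugacity ^ l.length * y ^ topCnt T l +
      ∑ c ∈ Icc (0 : ℤ) (2 * (T : ℤ) - 1), ∑ e ∈ Icc (0 : ℤ) (2 * (T : ℤ) - 1),
        headGFN T N c y * hb0GFN T N c e y * tailGFN T N e y) := by
  classical
  rw [stripGFy_beta_eq_sum_bridgeLists hT, bridgeLists_eq_caseA_union_caseB hT]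
  have hdisj : Disjoint (caseA T L) (caseB T L) := by
    rw [caseA, caseB, disjoint_filter]; intro l _ h1 h2; omega
  rw [sum_union hdisj]
  have hB := sum_caseB_le_sum_caseA hT hy (L := L)
  change ∑ l ∈ caseA T L, hexCriticalFugacity ^ l.length * y ^ topCnt T l +
    ∑ l ∈ caseB T L, hexCriticalFugacity ^ l.length * y ^ topCnt T l ≤ _
  -- case A = no renewal index ⊔ some renewal index
  have hsplit : ∑ l ∈ caseA T L, hexCriticalFugacity ^ l.length * y ^ topCnt T l =
      ∑ l ∈ noRenA T L, hexCriticalFugacity ^ l.length * y ^ topCnt T l +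
        ∑ l ∈ renA T L, hexCriticalFugacity ^ l.length * y ^ topCnt T l := by
    rw [noRenA, renA_eq_filter_caseA, ← sum_filter_add_sum_filter_not (caseA T L) (fun l => renIdxs l = ∅)]
    congr 1
    refine sum_congr ?_ fun _ _ => rfl
    ext l
    simp only [mem_filter, Finset.nonempty_iff_ne_empty]
  have hren := sum_renA_le_sum_pieces hT hN hy (L := L)
  linarith

end UpperSplit

/-! ### §2 Uniform bounds over the levels, and the middle pieces versus the bridges -/

section Uniform

/-- A bound for the head series at `y_T` uniform in the level AND the truncation (`T ≥ 2`). [cite: DuminilCopinHammond2013, §2.2; BeatonBousquetMelouDeGierDuminilCopinGuttmann2014, Corollary 8; lane «pcv-sawmu» a-p2 g21] -/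
theorem exists_headGFN_stripYT_le_all (hT : 2 ≤ T) : ∃ A : ℝ, 0 < A ∧ ∀ N (c : ℤ), headGFN T N c (stripYT T) ≤ A := by
  classical
  choose A hA using fun c : ℤ => exists_headGFN_stripYT_le hT c
  refine ⟨1 + ∑ c ∈ Icc (0 : ℤ) (2 * (T : ℤ) - 1), max (A c) 0,
    add_pos_of_pos_of_nonneg one_pos (sum_nonneg fun _ _ => le_max_right _ _), fun N c => ?_⟩
  by_cases hc : 0 ≤ c ∧ c ≤ 2 * (T : ℤ) - 1
  · have hmem : c ∈ Icc (0 : ℤ) (2 * (T : ℤ) - 1) := mem_Icc.2 hc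
    have h1 : max (A c) 0 ≤ ∑ c ∈ Icc (0 : ℤ) (2 * (T : ℤ) - 1), max (A c) 0 :=
      single_le_sum (f := fun c => max (A c) 0) (fun _ _ => le_max_right _ _) hmem
    linarith [hA c N, le_max_left (A c) 0]
  · rw [headGFN, headN_eq_empty_of_not_mem hc, sum_empty]
    linarith [sum_nonneg (fun c (_ : c ∈ Icc (0 : ℤ) (2 * (T : ℤ) - 1)) => le_max_right (A c) 0)]

/-- A bound for the tail series at `y_T` uniform in the level AND the truncation (`T ≥ 2`). [cite: DuminilCopinHammond2013, §2.2; BeatonBousquetMelouDeGierDuminilCopinGuttmann2014, Corollary 8; lane «pcv-sawmu» a-p2 g21] -/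
theorem exists_tailGFN_stripYT_le_all (hT : 2 ≤ T) : ∃ A : ℝ, 0 < A ∧ ∀ N (e : ℤ), tailGFN T N e (stripYT T) ≤ A := by
  classical
  choose A hA using fun e : ℤ => exists_tailGFN_stripYT_le hT e
  refine ⟨1 + ∑ e ∈ Icc (0 : ℤ) (2 * (T : ℤ) - 1), max (A e) 0,
    add_pos_of_pos_of_nonneg one_pos (sum_nonneg fun _ _ => le_max_right _ _), fun N e => ?_⟩
  by_cases he : 0 ≤ e ∧ e ≤ 2 * (T : ℤ) - 1
  · have hmem : e ∈ Icc (0 : ℤ) (2 * (T : ℤ) - 1) := mem_Icc.2 he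
    have h1 : max (A e) 0 ≤ ∑ e ∈ Icc (0 : ℤ) (2 * (T : ℤ) - 1), max (A e) 0 :=
      single_le_sum (f := fun e => max (A e) 0) (fun _ _ => le_max_right _ _) hmem
    linarith [hA e N, le_max_left (A e) 0]
  · rw [tailGFN, tailN_eq_empty_of_not_mem he, sum_empty]
    linarith [sum_nonneg (fun e (_ : e ∈ Icc (0 : ℤ) (2 * (T : ℤ) - 1)) => le_max_right (A e) 0)]

/-- The middle pieces versus the bridges with `y`-weights: `D⁰^{(N)}_{ce}(y) ≤ D_N(c,e)(y) + |stripChains T 0|` for `0 ≤ y`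
(any `y`: the one-vertex pieces weigh `1` each). [cite: DuminilCopinHammond2013, §2.2; lane plumbing] -/
theorem hb0GFN_le_Dab_add (y : ℝ) (N : ℕ) (c e : ℤ) :
    hb0GFN T N c e y ≤ Dab T N c e y + ((stripChains T 0).card : ℝ) := by
  classical
  have hx := hexCriticalFugacity_pos_lt_one
  rw [hb0GFN, Dab, ← sum_filter_add_sum_filter_not (HB0 T N c e) (fun b => 2 ≤ b.length)]
  refine add_le_add ?_ ?_
  · refine le_of_eq (sum_congr ?_ fun _ _ => rfl)
    ext b
    simp only [mem_filter, HB0, HBab]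
    tauto
  · have hsub : (HB0 T N c e).filter (fun b => ¬ 2 ≤ b.length) ⊆ stripChains T 0 := by
      intro b hb
      rw [mem_filter] at hb
      obtain ⟨hb0, hlen⟩ := hb
      obtain ⟨hc, hnd, -, hh, hin, -, hne, -⟩ := of_mem_HB0 hb0
      have h1 : b.length = 1 := by have := List.length_pos_of_ne_nil hne; omega
      refine mem_stripChains_iff.2 ⟨hc, hnd, h1, ?_, hin⟩
      obtain ⟨v, t, rfl⟩ := List.exists_cons_of_ne_nil hne
      exact ⟨v, rfl, hh (by simp)⟩
    calc ∑ b ∈ (HB0 T N c e).filter (fun b => ¬ 2 ≤ b.length), wD T y b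
        ≤ ∑ b ∈ (HB0 T N c e).filter (fun b => ¬ 2 ≤ b.length), (1 : ℝ) := by
          refine sum_le_sum fun b hb => ?_
          rw [mem_filter] at hb
          obtain ⟨hb0, hlen⟩ := hb
          obtain ⟨-, -, -, -, -, -, hne, -⟩ := of_mem_HB0 hb0
          have h1 : b.length = 1 := by have := List.length_pos_of_ne_nil hne; omega
          obtain ⟨v, t, rfl⟩ := List.exists_cons_of_ne_nil hne
          have ht : t = [] := by simpa using h1
          subst ht
          simp [wD, topCnt]
      _ ≤ ∑ b ∈ stripChains T 0, (1 : ℝ) := sum_le_sum_of_subset_of_nonneg hsub fun _ _ _ => zero_le_one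
      _ = ((stripChains T 0).card : ℝ) := by simp

end Uniform

/-! ### §3 The bridges of a box by number of steps: `D_N(a,b) = Σ_{σ=1}^{N} (length slice σ)`, and the cumulative upper law -/

section Cumulative

variable {N : ℕ} {y : ℝ}

/-- `D_N(a,b)(y) = Σ_{σ = 1}^{N} LUs T N σ a b y` — a bridge with at most `N + 1` and at least two vertices has `1 ≤ σ ≤ N` steps.
[cite: DuminilCopinHammond2013, §2.2 (the length of a bridge); lane plumbing] -/
theorem Dab_eq_sum_LUs (N : ℕ) (a b : ℤ) (y : ℝ) : Dab T N a b y = ∑ σ ∈ Icc (1 : ℤ) N, LUs T N σ a b y := by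
  classical
  rw [Dab]
  simp only [LUs, LUset]
  rw [sum_fiberwise_of_maps_to]
  intro l hl
  rw [HBab, mem_filter, mem_hBridgesN_iff] at hl
  obtain ⟨⟨-, -, hlenN, -⟩, h2, -⟩ := hl
  rw [mem_Icc]
  unfold hlen
  constructor <;> omega

/-- ★★ **Cumulative upper law in length**: `Σ_{a,b} D_N(a,b)(y_T) ≤ (2T)² · K · N` for every `N` (`T ≥ 1`), from the length-pointwise law
`LUs T N σ a b (y_T) ≤ K`. [cite: DuminilCopinHammond2013, §2.2; BeatonBousquetMelouDeGierDuminilCopinGuttmann2014, Corollary 8; lane «pcv-sawmu» a-p2 g17/g21] -/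
theorem exists_sum_Dab_stripYT_le_linear (hT : 1 ≤ T) :
    ∃ K : ℝ, 0 ≤ K ∧ ∀ N : ℕ, ∑ a : Fin (2 * T), ∑ b : Fin (2 * T), Dab T N (a : ℕ) (b : ℕ) (stripYT T) ≤ K * N := by
  obtain ⟨K, hK⟩ := exists_LUs_stripYT_le hT
  have hy := (stripYT_pos hT).le
  have hK0 : 0 ≤ K := le_trans (LUs_LMs_nonneg (T := T) (N := 0) (σ := 0) hy 0 0).1 (hK 0 0 ⟨0, by omega⟩ ⟨0, by omega⟩)
  refine ⟨((Fintype.card (Fin (2 * T)) : ℝ) * (Fintype.card (Fin (2 * T)) : ℝ)) * K, by positivity, fun N => ?_⟩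
  have h1 : ∀ a b : Fin (2 * T), Dab T N (a : ℕ) (b : ℕ) (stripYT T) ≤ K * N := by
    intro a b
    rw [Dab_eq_sum_LUs]
    calc ∑ σ ∈ Icc (1 : ℤ) N, LUs T N σ (a : ℕ) (b : ℕ) (stripYT T) ≤ ∑ σ ∈ Icc (1 : ℤ) N, K :=
          sum_le_sum fun σ _ => hK N σ a b
      _ = K * N := by rw [sum_const, Int.card_Icc, nsmul_eq_mul]; simp [mul_comm]
  calc ∑ a : Fin (2 * T), ∑ b : Fin (2 * T), Dab T N (a : ℕ) (b : ℕ) (stripYT T)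
      ≤ ∑ a : Fin (2 * T), ∑ b : Fin (2 * T), K * N := sum_le_sum fun a _ => sum_le_sum fun b _ => h1 a b
    _ = ((Fintype.card (Fin (2 * T)) : ℝ) * (Fintype.card (Fin (2 * T)) : ℝ)) * K * N := by
        rw [sum_const, sum_const, nsmul_eq_mul, nsmul_eq_mul, Finset.card_univ]; ring

end Cumulative

/-! ### §4 ★★★ The cumulative LOWER law in length at the threshold -/

section Lower

/-- ★★★ **THE LINEAR LOWER LAW IN LENGTH FOR THE CRITICAL BRIDGES AT THE THRESHOLD** (`T ≥ 2`): there are `c > 0` and `C` with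
`c · N − C ≤ Σ_{a,b} D_N(a,b)(y_T)` for every `N` — the standard horizontal bridges of `S_T` with at most `N + 1` vertices, weighted
`x_c^{|h|−1} y_T^{#top}`, have total weight of order `N` (with §3: exactly order `N`).  Route: choose the box `S_{T,L}` with
`|V(S_{T,L})| ≤ N + 1` (`L ≍ N`); its β-series at `y_T` is `≥ c₀ (L+1) − C₀` (the tree's linear lower law `exists_linear_le_stripGFy_beta_stripYT`)
and `≤ 2 (Σ_{N₀^A} + Σ_{c,e} F^{(N)}_c D⁰^{(N)}_{ce} G^{(N)}_e)` (§1); the no-renewal class is bounded («BETA-NORENEWAL»), the head and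
tail series are bounded at `y_T` («BETA-COEFF» §4), and `D⁰ ≤ D + |stripChains T 0|`.  This is the first-order LOWER bound in the
LENGTH variable that the lane's length programme was missing (HANDOFF a-p2 g19 (B)).
[cite: DuminilCopinHammond2013, §2.2; BeatonBousquetMelouDeGierDuminilCopinGuttmann2014, Corollary 8 (arXiv v5 p. 12); DuminilCopinSmirnov2012, §3; lane «pcv-sawmu» a-p2 g21 — own result] -/
theorem exists_linear_le_sum_Dab_stripYT (hT : 2 ≤ T) :
    ∃ c : ℝ, 0 < c ∧ ∃ C : ℝ, ∀ N : ℕ,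
      c * N - C ≤ ∑ a : Fin (2 * T), ∑ b : Fin (2 * T), Dab T N (a : ℕ) (b : ℕ) (stripYT T) := by
  classical
  have hT1 : 1 ≤ T := by omega
  have hx := hexCriticalFugacity_pos_lt_one
  have hyT := one_lt_stripYT hT1
  have hy0 : 0 ≤ stripYT T := by linarith
  obtain ⟨c₀, hc₀, C₀, hlow⟩ := exists_linear_le_stripGFy_beta_stripYT hT1 (T := T)
  obtain ⟨Cn, hCn⟩ := exists_sum_noRenA_stripYT_le hT
  obtain ⟨AF, hAF0, hAF⟩ := exists_headGFN_stripYT_le_all hT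
  obtain ⟨AG, hAG0, hAG⟩ := exists_tailGFN_stripYT_le_all hT
  set K₀ : ℝ := ((stripChains T 0).card : ℝ) with hK₀
  set M : ℝ := ((Icc (0 : ℤ) (2 * (T : ℤ) - 1)).card : ℝ) with hM
  -- constants: `|V(S_{T,L})| ≤ 4(T+1)L + 2(T+1)²`; for `N + 1 ≥ 2(T+1)²` pick `L = (N + 1 − 2(T+1)²) / (4(T+1))`
  set p : ℕ := 4 * (T + 1) with hp
  set q : ℕ := 2 * (T + 1) ^ 2 with hq
  have hp0 : 0 < p := by rw [hp]; omega
  have hp' : (0 : ℝ) < p := by exact_mod_cast hp0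
  have hFG : 0 < 2 * (AF * AG) := by positivity
  have hSD0 : ∀ N, 0 ≤ ∑ a : Fin (2 * T), ∑ b : Fin (2 * T), Dab T N (a : ℕ) (b : ℕ) (stripYT T) := fun N =>
    sum_nonneg fun a _ => sum_nonneg fun b _ => sum_nonneg fun l _ => wD_nonneg T hy0 l
  set c : ℝ := c₀ / (p * (2 * (AF * AG))) with hc
  have hc0 : 0 < c := by positivity
  set C₁ : ℝ := (c₀ * q / p + C₀ + 2 * Cn) / (2 * (AF * AG)) + M * M * K₀ with hC₁
  refine ⟨c, hc0, max C₁ 0 + c * q, fun N => ?_⟩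
  rcases lt_or_ge N q with hNq | hNq
  · -- small `N`: the left side is non-positive
    have h1 : c * N ≤ c * q := mul_le_mul_of_nonneg_left (by exact_mod_cast hNq.le) hc0.le
    linarith [le_max_right C₁ 0, hSD0 N]
  -- the box
  set L : ℕ := (N + 1 - q) / p with hL
  have hcard : (stripV T L).card ≤ N + 1 := by
    have h1 := LinLow.card_stripV_le_affine T L
    have h2 : p * L ≤ N + 1 - q := by rw [hL]; exact Nat.mul_div_le (N + 1 - q) p
    rw [← hp, ← hq] at h1
    omega
  -- `c₀ (L+1) − C₀ ≤ B_{T,L}(y_T) ≤ 2 (Cn + AF AG Σ D⁰)`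
  have hB := hlow L
  have hsplit := stripGFy_beta_le_two_mul_renewal hT1 hcard hy0 (T := T) (L := L)
  have hS : ∑ c ∈ Icc (0 : ℤ) (2 * (T : ℤ) - 1), ∑ e ∈ Icc (0 : ℤ) (2 * (T : ℤ) - 1),
      headGFN T N c (stripYT T) * hb0GFN T N c e (stripYT T) * tailGFN T N e (stripYT T) ≤
      AF * AG * ∑ c ∈ Icc (0 : ℤ) (2 * (T : ℤ) - 1), ∑ e ∈ Icc (0 : ℤ) (2 * (T : ℤ) - 1), hb0GFN T N c e (stripYT T) := by
    rw [mul_sum]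
    refine sum_le_sum fun c _ => ?_
    rw [mul_sum]
    refine sum_le_sum fun e _ => ?_
    have hF := hAF N c
    have hG := hAG N e
    have hG0 := tailGFN_nonneg hy0 N e (T := T)
    have hD0 := hb0GFN_nonneg hy0 N c e (T := T)
    calc headGFN T N c (stripYT T) * hb0GFN T N c e (stripYT T) * tailGFN T N e (stripYT T)
        ≤ AF * hb0GFN T N c e (stripYT T) * AG :=
          mul_le_mul (mul_le_mul_of_nonneg_right hF hD0) hG hG0 (mul_nonneg hAF0.le hD0)
      _ = AF * AG * hb0GFN T N c e (stripYT T) := by ring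
  have hD : ∑ c ∈ Icc (0 : ℤ) (2 * (T : ℤ) - 1), ∑ e ∈ Icc (0 : ℤ) (2 * (T : ℤ) - 1), hb0GFN T N c e (stripYT T) ≤
      ∑ a : Fin (2 * T), ∑ b : Fin (2 * T), Dab T N (a : ℕ) (b : ℕ) (stripYT T) + M * M * K₀ := by
    rw [sum_Icc_levels_eq_sum_fin]
    simp_rw [sum_Icc_levels_eq_sum_fin]
    have h1 : ∑ a : Fin (2 * T), ∑ b : Fin (2 * T), hb0GFN T N (a : ℕ) (b : ℕ) (stripYT T) ≤
        ∑ a : Fin (2 * T), ∑ b : Fin (2 * T), (Dab T N (a : ℕ) (b : ℕ) (stripYT T) + K₀) :=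
      sum_le_sum fun a _ => sum_le_sum fun b _ => hb0GFN_le_Dab_add _ N _ _
    refine h1.trans (le_of_eq ?_)
    simp only [sum_add_distrib, sum_const, Finset.card_univ, nsmul_eq_mul, hM, Int.card_Icc]
    have hcast : ((Fintype.card (Fin (2 * T)) : ℝ)) = (((2 * (T : ℤ) - 1 + 1 - 0).toNat : ℕ) : ℝ) := by
      rw [Fintype.card_fin]; congr 1; omega
    rw [hcast]; ring
  -- arithmetic: `c₀ (L + 1) ≥ c₀ (N + 1 − q)/p ≥ (c₀/p) N − c₀ q/p`
  have hLN : (c₀ / p) * N - c₀ * q / p ≤ c₀ * ((L : ℝ) + 1) := by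
    have h1 : (N : ℝ) + 1 - q ≤ p * ((L : ℝ) + 1) := by
      have h2 : N + 1 - q < p * (L + 1) := by
        rw [hL, Nat.mul_add, mul_one]
        have := Nat.lt_div_mul_add (a := N + 1 - q) hp0
        rw [mul_comm] at this
        omega
      have h3 : ((N + 1 - q : ℕ) : ℝ) = (N : ℝ) + 1 - q := by
        push_cast [Nat.cast_sub (show q ≤ N + 1 by omega)]; ring
      have h4 : ((N + 1 - q : ℕ) : ℝ) < (p : ℝ) * ((L : ℝ) + 1) := by exact_mod_cast h2
      linarith
    have h5 : c₀ / p * ((N : ℝ) + 1 - q) ≤ c₀ * ((L : ℝ) + 1) := by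
      have := mul_le_mul_of_nonneg_left h1 (div_pos hc₀ hp').le
      calc c₀ / p * ((N : ℝ) + 1 - q) ≤ c₀ / p * (p * ((L : ℝ) + 1)) := this
        _ = c₀ * ((L : ℝ) + 1) := by field_simp
    have h6 : c₀ / p * ((N : ℝ) + 1 - q) = c₀ / p * N + c₀ / p - c₀ * q / p := by ring
    have h7 : 0 < c₀ / p := div_pos hc₀ hp'
    linarith
  -- assemble
  have hchain : c₀ / p * N - c₀ * q / p - C₀ - 2 * Cn ≤
      2 * (AF * AG) * (∑ a : Fin (2 * T), ∑ b : Fin (2 * T), Dab T N (a : ℕ) (b : ℕ) (stripYT T) + M * M * K₀) := by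
    have h2 := hCn L
    have h3 : AF * AG * ∑ c ∈ Icc (0 : ℤ) (2 * (T : ℤ) - 1), ∑ e ∈ Icc (0 : ℤ) (2 * (T : ℤ) - 1), hb0GFN T N c e (stripYT T)
        ≤ AF * AG * (∑ a : Fin (2 * T), ∑ b : Fin (2 * T), Dab T N (a : ℕ) (b : ℕ) (stripYT T) + M * M * K₀) :=
      mul_le_mul_of_nonneg_left hD (mul_nonneg hAF0.le hAG0.le)
    linarith
  have hdiv : (c₀ / p * N - c₀ * q / p - C₀ - 2 * Cn) / (2 * (AF * AG)) ≤
      ∑ a : Fin (2 * T), ∑ b : Fin (2 * T), Dab T N (a : ℕ) (b : ℕ) (stripYT T) + M * M * K₀ := by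
    rw [div_le_iff₀ hFG]
    linarith
  have hcalc : c * N - C₁ = (c₀ / p * N - c₀ * q / p - C₀ - 2 * Cn) / (2 * (AF * AG)) - M * M * K₀ := by
    rw [hc, hC₁]
    field_simp
    ring
  have hcq : 0 ≤ c * q := by positivity
  linarith [le_max_left C₁ 0]

end Lower

end HV

end Literature.Probability.RandomPlanarGeometry.SAW
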